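import Mathlib.Algebra.Algebra.Subalgebra.Basic
import Mathlib.RingTheory.TensorProduct.Maps
import Mathlib.RingTheory.Flat.Basic
import Mathlib.LinearAlgebra.Finsupp.LinearCombination
import Mathlib.LinearAlgebra.FiniteDimensional.Lemmas
import Mathlib.RingTheory.Norm.Basic
import Mathlib.RingTheory.TensorProduct.Free
import Mathlib.Algebra.CharP.Invertible
import Literature.NumberTheory.AdelicBaseChange.AdeleNormTrace
import HarnessLib

/-!
# Descent along a semilinear involution of a commutative algebra over a quadratic extension, and the norm of a
# base-changed element (Cassels–Fröhlich II §19 (19.5), (19.15)–(19.17); Rogawski 1990 §3.5 «det x_g = ∏ N_{K_𝔪∕L}»)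

Topic `RingTheory/Etale`; namespace `Literature.RingTheory.Etale`.  THEOREMS ONLY (no definition, no instance, no notation, no
named fact, no `sorry`); universe `Type` (the tree's adelic files are stated in `Type`); pure algebra.

SETTING.  `F` a field, `B` a commutative `F`-algebra, `τ : B ≃ₐ[F] B` with `τ ∘ τ = 1`; the FIXED SUBALGEBRA is Mathlib's
`B₀ := AlgHom.equalizer ↑τ (AlgHom.id F B)` (no new definition).  For a commutative `F`-algebra `A` (in the application `A = 𝔸_F`):

* §1 DESCENT OF `τ`-FIXED POINTS OF `A ⊗_F B` TO `A ⊗_F B₀` (`char F = 0`): **`exists_map_val_eq_of_map_eq`** — `(1 ⊗ τ) z = z ⇒ z = (1 ⊗ ι) z₀`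
  (`z = ½ (z + (1⊗τ) z)` and `w + (1 ⊗ τ) w` is in the range for every `w`); **`map_val_injective`** (`A` is flat over the field `F`);
  **`exists_unitsMap_eq_of_map_eq`** (units descend to units).
* §2 `L ⊇ F` QUADRATIC, `B` an `L`-algebra, `τ` `σ`-SEMILINEAR (`τ (ℓ • b) = σ ℓ • τ b`, `σ ∈ Aut(L/F)`, `σ ≠ 1`): **`bijective_lift_ofId_val`** —
  the multiplication map `L ⊗_F B₀ → B` is an isomorphism (`ε := ℓ − σ ℓ ≠ 0`, `σ ε = −ε`; `b = ½(b + τ b) + ε · (ε⁻¹ ½ (b − τ b))`;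
  `{1, ε}` an `F`-basis of `L`).
* §3 THE NORM OF A BASE-CHANGED ELEMENT: for an `L`-algebra `A'` and `φ : A →ₐ[F] A'`, with `θ : A ⊗_F B → A' ⊗_L B`, `a ⊗ b ↦ φ a ⊗ b`:
  **`norm_lift_map_val_eq`** — `N_{(A' ⊗_L B)/A'}(θ ((1 ⊗ ι) x₀)) = φ (N_{(A ⊗_F B₀)/A}(x₀))` for `x₀ ∈ A ⊗_F B₀` (`B` finite-dimensional):
  naturality of the regular representation in the base (★ `AdelicBaseChange.leftMulMatrix_basis_map`, Cassels–Fröhlich (19.15)–(19.17))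
  and the `A'`-algebra isomorphism `A' ⊗_F B₀ ≅ A' ⊗_L (L ⊗_F B₀) ≅ A' ⊗_L B` (Mathlib `cancelBaseChange` + §2).

USE (cell hodgecm-mathlib, ENGINE T1 row G6, det-reading (Ⅱ) for R6d (C) `sum_cartanObsFun_eq_zero`): `B = L[γ₀]` the Cartan algebra of a
regular `γ₀ ∈ U(3)`, `τ` the adjoint involution, `A = 𝔸_{L⁺}`, `A' = 𝔸_L`, `φ = con`: the adelic Cartan class `X = x_g` is `τ`-fixed, so
`X = (1⊗ι) X₀` and `det x_g = N(θ X) = con (N_{(𝔸_{L⁺} ⊗ B₀)/𝔸_{L⁺}} X₀)`, which then splits over the maximal ideals of `B₀`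
[Rogawski1990, §3.5 p. 29–30].  HC_CM is proved only modulo the printed citations until rung 0 closes.

## References
* [CasselsFrohlichANT1967] J. W. S. Cassels, A. Fröhlich (eds.), *Algebraic Number Theory* (1967), Ch. II §19 (19.5), (19.15)–(19.17).
* [Rogawski1990] J. D. Rogawski, *Automorphic Representations of Unitary Groups in Three Variables* (1990), §3.5 Prop. 3.5.2 p. 29–30.
* [Lang2002] S. Lang, *Algebra*, rev. 3rd ed. (2002), Ch. VI §5 Prop. 5.6 (norm and base change), Ch. XVI §7.
-/

set_option autoImplicit false

open scoped TensorProduct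

namespace Literature.RingTheory.Etale

open Algebra.TensorProduct (map includeLeft includeRight lift)

/-! ## §1 Descent of `τ`-fixed points of `A ⊗_F B` to `A ⊗_F B^τ` -/

section Descent

variable {F : Type} [Field F] {B : Type} [CommRing B] [Algebra F B] (τ : B ≃ₐ[F] B)
  {A : Type} [CommRing A] [Algebra F A]

/-- `b + τ b` is `τ`-fixed when `τ` is an involution. [cite: CasselsFrohlichANT1967, Ch. II §19 (19.5)] -/
theorem add_apply_mem_equalizer (hτ : ∀ b, τ (τ b) = b) (b : B) :
    b + τ b ∈ AlgHom.equalizer (τ : B →ₐ[F] B) (AlgHom.id F B) := by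
  rw [AlgHom.mem_equalizer]
  change τ (b + τ b) = b + τ b
  rw [map_add, hτ, add_comm]

/-- `w + (1 ⊗ τ) w` lies in `A ⊗_F B^τ` for EVERY `w ∈ A ⊗_F B`. [cite: CasselsFrohlichANT1967, Ch. II §19 (19.5)] -/
theorem exists_map_val_eq_add_map (hτ : ∀ b, τ (τ b) = b) (w : A ⊗[F] B) :
    ∃ w₀ : A ⊗[F] ↥(AlgHom.equalizer (τ : B →ₐ[F] B) (AlgHom.id F B)),
      map (AlgHom.id F A) (AlgHom.equalizer (τ : B →ₐ[F] B) (AlgHom.id F B)).val w₀ =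
        w + map (AlgHom.id F A) (τ : B →ₐ[F] B) w := by
  induction w using TensorProduct.induction_on with
  | zero => exact ⟨0, by rw [map_zero, map_zero, add_zero]⟩
  | tmul a b =>
      refine ⟨a ⊗ₜ ⟨b + τ b, add_apply_mem_equalizer τ hτ b⟩, ?_⟩
      rw [Algebra.TensorProduct.map_tmul, Algebra.TensorProduct.map_tmul, AlgHom.id_apply, Subalgebra.coe_val]
      change a ⊗ₜ (b + τ b) = a ⊗ₜ b + a ⊗ₜ τ b
      rw [TensorProduct.tmul_add]
  | add x y hx hy =>
      obtain ⟨x₀, hx₀⟩ := hx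
      obtain ⟨y₀, hy₀⟩ := hy
      exact ⟨x₀ + y₀, by rw [map_add, hx₀, hy₀, map_add]; abel⟩

/-- **DESCENT**: a `(1 ⊗ τ)`-fixed element of `A ⊗_F B` comes from `A ⊗_F B^τ` (`char F = 0`: `z = ½ (z + (1 ⊗ τ) z)`).
[cite: CasselsFrohlichANT1967, Ch. II §19 (19.5)] -/
theorem exists_map_val_eq_of_map_eq [CharZero F] (hτ : ∀ b, τ (τ b) = b) (z : A ⊗[F] B)
    (hz : map (AlgHom.id F A) (τ : B →ₐ[F] B) z = z) :
    ∃ z₀ : A ⊗[F] ↥(AlgHom.equalizer (τ : B →ₐ[F] B) (AlgHom.id F B)),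
      map (AlgHom.id F A) (AlgHom.equalizer (τ : B →ₐ[F] B) (AlgHom.id F B)).val z₀ = z := by
  obtain ⟨w₀, hw₀⟩ := exists_map_val_eq_add_map τ hτ z
  refine ⟨(2 : F)⁻¹ • w₀, ?_⟩
  rw [map_smul, hw₀, hz, ← two_smul F z, smul_smul, inv_mul_cancel₀ (two_ne_zero' F), one_smul]

/-- `1 ⊗ ι : A ⊗_F S → A ⊗_F B` is injective for every subalgebra `S ≤ B` (`A` is flat over the field `F`).
[cite: CasselsFrohlichANT1967, Ch. II §19 (19.1)] -/
theorem map_val_injective (S : Subalgebra F B) : Function.Injective (map (AlgHom.id F A) S.val) := by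
  have key : ∀ z, map (AlgHom.id F A) S.val z = LinearMap.lTensor A (S.val.toLinearMap) z := by
    intro z
    induction z using TensorProduct.induction_on with
    | zero => rw [map_zero, map_zero]
    | tmul a s => rw [Algebra.TensorProduct.map_tmul, LinearMap.lTensor_tmul]; rfl
    | add x y hx hy => rw [map_add, map_add, hx, hy]
  intro z z' h
  rw [key, key] at h
  exact Module.Flat.lTensor_preserves_injective_linearMap S.val.toLinearMap (fun s s' hs => Subtype.ext hs) h

/-- **Units descend to units**: a `(1 ⊗ τ)`-fixed UNIT of `A ⊗_F B` is `(1 ⊗ ι) X₀` for a unit `X₀` of `A ⊗_F B^τ`.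
[cite: CasselsFrohlichANT1967, Ch. II §19 (19.5)] -/
theorem exists_unitsMap_eq_of_map_eq [CharZero F] (hτ : ∀ b, τ (τ b) = b) (X : (A ⊗[F] B)ˣ)
    (hX : map (AlgHom.id F A) (τ : B →ₐ[F] B) ↑X = ↑X) :
    ∃ X₀ : (A ⊗[F] ↥(AlgHom.equalizer (τ : B →ₐ[F] B) (AlgHom.id F B)))ˣ,
      Units.map (map (AlgHom.id F A) (AlgHom.equalizer (τ : B →ₐ[F] B) (AlgHom.id F B)).val).toRingHom.toMonoidHom X₀ = X := by
  have hX' : map (AlgHom.id F A) (τ : B →ₐ[F] B) ↑X⁻¹ = ↑X⁻¹ := by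
    have h1 : map (AlgHom.id F A) (τ : B →ₐ[F] B) ↑X⁻¹ * ↑X = 1 := by
      conv_lhs => rw [← hX]
      rw [← map_mul, Units.inv_mul, map_one]
    calc map (AlgHom.id F A) (τ : B →ₐ[F] B) ↑X⁻¹ = map (AlgHom.id F A) (τ : B →ₐ[F] B) ↑X⁻¹ * (↑X * ↑X⁻¹) := by
          rw [Units.mul_inv, mul_one]
      _ = ↑X⁻¹ := by rw [← mul_assoc, h1, one_mul]
  obtain ⟨x₀, hx₀⟩ := exists_map_val_eq_of_map_eq (A := A) τ hτ _ hX
  obtain ⟨y₀, hy₀⟩ := exists_map_val_eq_of_map_eq (A := A) τ hτ _ hX'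
  have hxy : x₀ * y₀ = 1 :=
    map_val_injective (A := A) (AlgHom.equalizer (τ : B →ₐ[F] B) (AlgHom.id F B)) (by rw [map_mul, hx₀, hy₀, Units.mul_inv, map_one])
  exact ⟨⟨x₀, y₀, hxy, by rw [mul_comm]; exact hxy⟩, Units.ext hx₀⟩

end Descent

/-! ## §2 `L ⊗_F B^τ ≅ B` for a `σ`-semilinear involution over a quadratic extension `L ⊇ F` -/

section Quadratic

variable {F : Type} [Field F] {L : Type} [Field L] [Algebra F L] {B : Type} [CommRing B] [Algebra F B] [Algebra L B]
  [IsScalarTower F L B] (τ : B ≃ₐ[F] B) (σ : L ≃ₐ[F] L)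

/-- A non-trivial involution `σ` of `L/F` has a non-zero anti-invariant element `ε = ℓ − σ ℓ` (`σ ε = −ε`).
[cite: Lang2002, Ch. VI §5 Prop. 5.6] -/
theorem exists_ne_zero_apply_eq_neg (hσ : σ * σ = 1) (hσ1 : σ ≠ 1) : ∃ ε : L, ε ≠ 0 ∧ σ ε = -ε := by
  obtain ⟨ℓ, hℓ⟩ : ∃ ℓ, σ ℓ ≠ ℓ := by
    by_contra h
    exact hσ1 (AlgEquiv.ext fun ℓ => not_not.mp (not_exists.mp h ℓ))
  refine ⟨ℓ - σ ℓ, sub_ne_zero.mpr (Ne.symm hℓ), ?_⟩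
  have hℓℓ : σ (σ ℓ) = ℓ := by rw [← AlgEquiv.mul_apply, hσ, AlgEquiv.one_apply]
  rw [map_sub, hℓℓ, neg_sub]

/-- `{1, ε}` is an `F`-basis of the quadratic extension `L`: every `ℓ ∈ L` is `a + c ε`, `a, c ∈ F`. [cite: Lang2002, Ch. VI §5 Prop. 5.6] -/
theorem exists_eq_algebraMap_add_smul [CharZero F] (h2 : Module.finrank F L = 2) {ε : L} (hε0 : ε ≠ 0) (hε : σ ε = -ε) (ℓ : L) :
    ∃ a c : F, ℓ = algebraMap F L a + c • ε := by
  haveI : FiniteDimensional F L := Module.finite_of_finrank_eq_succ h2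
  haveI : CharZero L := charZero_of_injective_algebraMap (algebraMap F L).injective
  have hli : LinearIndependent F ![(1 : L), ε] := by
    rw [LinearIndependent.pair_iff]
    intro s t hst
    rw [Algebra.smul_def, mul_one, Algebra.smul_def] at hst
    have h1 : algebraMap F L s - algebraMap F L t * ε = 0 := by
      have h := congrArg σ hst
      rw [map_add, map_mul, AlgEquiv.commutes, AlgEquiv.commutes, hε, map_zero, mul_neg, ← sub_eq_add_neg] at h
      exact h
    have ht2 : (2 : L) * (algebraMap F L t * ε) = 0 := by linear_combination hst - h1
    have ht : algebraMap F L t = 0 := by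
      rcases mul_eq_zero.mp ht2 with h | h
      · exact absurd h two_ne_zero
      · exact (mul_eq_zero.mp h).resolve_right hε0
    have hs : algebraMap F L s = 0 := by rw [ht, zero_mul, add_zero] at hst; exact hst
    exact ⟨(algebraMap F L).injective (by rw [hs, map_zero]), (algebraMap F L).injective (by rw [ht, map_zero])⟩
  have hspan := hli.span_eq_top_of_card_eq_finrank' (by rw [Fintype.card_fin, h2])
  have hℓ : ℓ ∈ Submodule.span F (Set.range ![(1 : L), ε]) := by rw [hspan]; exact Submodule.mem_top
  obtain ⟨c, hc⟩ := (Submodule.mem_span_range_iff_exists_fun (R := F)).mp hℓ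
  refine ⟨c 0, c 1, ?_⟩
  rw [← hc, Fin.sum_univ_two, Matrix.cons_val_zero, Matrix.cons_val_one, Matrix.cons_val_fin_one,
    Algebra.algebraMap_eq_smul_one]

/-- The multiplication map `Λ : L ⊗_F B^τ → B`, `ℓ ⊗ b ↦ ℓ · b`, on pure tensors. [cite: CasselsFrohlichANT1967, Ch. II §19 (19.5)] -/
theorem lift_ofId_val_tmul (ℓ : L) (b₀ : ↥(AlgHom.equalizer (τ : B →ₐ[F] B) (AlgHom.id F B))) :
    lift (Algebra.ofId L B) (AlgHom.equalizer (τ : B →ₐ[F] B) (AlgHom.id F B)).val (fun _ _ => Commute.all _ _) (ℓ ⊗ₜ b₀) =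
      ℓ • (b₀ : B) := by
  rw [Algebra.TensorProduct.lift_tmul, Algebra.ofId_apply, Subalgebra.coe_val, Algebra.smul_def]

omit [IsScalarTower F L B] in
/-- `ε⁻¹ (b − τ b)` is `τ`-fixed when `τ` is `σ`-semilinear and `σ ε = −ε`. [cite: Lang2002, Ch. VI §5 Prop. 5.6] -/
theorem inv_smul_sub_apply_mem_equalizer (hτ : ∀ b, τ (τ b) = b) (hτσ : ∀ (ℓ : L) (b : B), τ (ℓ • b) = σ ℓ • τ b)
    {ε : L} (hε : σ ε = -ε) (b : B) :
    ε⁻¹ • (b - τ b) ∈ AlgHom.equalizer (τ : B →ₐ[F] B) (AlgHom.id F B) := by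
  rw [AlgHom.mem_equalizer]
  change τ (ε⁻¹ • (b - τ b)) = ε⁻¹ • (b - τ b)
  rw [hτσ, map_sub, hτ, map_inv₀, hε, inv_neg, neg_smul, ← smul_neg, neg_sub]

/-- **`Λ : L ⊗_F B^τ → B` is SURJECTIVE**: `b = ½ (b + τ b) + ε · (ε⁻¹ ½ (b − τ b))` with both `b + τ b` and `ε⁻¹(b − τ b)` fixed by `τ`.
[cite: Lang2002, Ch. VI §5 Prop. 5.6] [cite: CasselsFrohlichANT1967, Ch. II §19 (19.5)] -/
theorem surjective_lift_ofId_val [CharZero F] (hτ : ∀ b, τ (τ b) = b) (hσ : σ * σ = 1) (hσ1 : σ ≠ 1)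
    (hτσ : ∀ (ℓ : L) (b : B), τ (ℓ • b) = σ ℓ • τ b) :
    Function.Surjective
      (lift (Algebra.ofId L B) (AlgHom.equalizer (τ : B →ₐ[F] B) (AlgHom.id F B)).val (fun _ _ => Commute.all _ _)) := by
  obtain ⟨ε, hε0, hε⟩ := exists_ne_zero_apply_eq_neg σ hσ hσ1
  haveI : CharZero L := charZero_of_injective_algebraMap (algebraMap F L).injective
  intro b
  refine ⟨(2 : L)⁻¹ ⊗ₜ ⟨b + τ b, add_apply_mem_equalizer τ hτ b⟩ +
      ((2 : L)⁻¹ * ε) ⊗ₜ ⟨ε⁻¹ • (b - τ b), inv_smul_sub_apply_mem_equalizer τ σ hτ hτσ hε b⟩, ?_⟩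
  rw [map_add, lift_ofId_val_tmul, lift_ofId_val_tmul]
  change (2 : L)⁻¹ • (b + τ b) + ((2 : L)⁻¹ * ε) • (ε⁻¹ • (b - τ b)) = b
  rw [smul_smul, mul_assoc, mul_inv_cancel₀ hε0, mul_one, ← smul_add, add_add_sub_cancel, ← two_smul L b, smul_smul,
    inv_mul_cancel₀ (two_ne_zero' L), one_smul]

omit [Algebra L B] [IsScalarTower F L B] in
/-- Every element of `L ⊗_F B^τ` is `1 ⊗ u + ε ⊗ v` (`{1, ε}` an `F`-basis of `L`). [cite: Lang2002, Ch. VI §5 Prop. 5.6] -/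
theorem exists_eq_one_tmul_add_tmul [CharZero F] (h2 : Module.finrank F L = 2) {ε : L} (hε0 : ε ≠ 0) (hε : σ ε = -ε)
    (t : L ⊗[F] ↥(AlgHom.equalizer (τ : B →ₐ[F] B) (AlgHom.id F B))) :
    ∃ u v : ↥(AlgHom.equalizer (τ : B →ₐ[F] B) (AlgHom.id F B)), t = (1 : L) ⊗ₜ u + ε ⊗ₜ v := by
  induction t using TensorProduct.induction_on with
  | zero => exact ⟨0, 0, by rw [TensorProduct.tmul_zero, TensorProduct.tmul_zero, add_zero]⟩
  | tmul ℓ b₀ =>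
      obtain ⟨a, c, rfl⟩ := exists_eq_algebraMap_add_smul σ h2 hε0 hε ℓ
      refine ⟨a • b₀, c • b₀, ?_⟩
      rw [TensorProduct.add_tmul, Algebra.algebraMap_eq_smul_one, TensorProduct.smul_tmul, TensorProduct.smul_tmul]
  | add x y hx hy =>
      obtain ⟨u, v, rfl⟩ := hx
      obtain ⟨u', v', rfl⟩ := hy
      exact ⟨u + u', v + v', by rw [TensorProduct.tmul_add, TensorProduct.tmul_add]; abel⟩

/-- **`Λ : L ⊗_F B^τ → B` is INJECTIVE** (`L ⊇ F` quadratic): `u + ε v = 0 = τ(u + ε v) = u − ε v` forces `u = v = 0`.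
[cite: Lang2002, Ch. VI §5 Prop. 5.6] [cite: CasselsFrohlichANT1967, Ch. II §19 (19.5)] -/
theorem injective_lift_ofId_val [CharZero F] (h2 : Module.finrank F L = 2) (hσ : σ * σ = 1) (hσ1 : σ ≠ 1)
    (hτσ : ∀ (ℓ : L) (b : B), τ (ℓ • b) = σ ℓ • τ b) :
    Function.Injective
      (lift (Algebra.ofId L B) (AlgHom.equalizer (τ : B →ₐ[F] B) (AlgHom.id F B)).val (fun _ _ => Commute.all _ _)) := by
  obtain ⟨ε, hε0, hε⟩ := exists_ne_zero_apply_eq_neg σ hσ hσ1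
  haveI : CharZero L := charZero_of_injective_algebraMap (algebraMap F L).injective
  rw [injective_iff_map_eq_zero]
  intro t ht
  obtain ⟨u, v, rfl⟩ := exists_eq_one_tmul_add_tmul τ σ h2 hε0 hε t
  rw [map_add, lift_ofId_val_tmul, lift_ofId_val_tmul, one_smul] at ht
  have hu : τ (u : B) = u := u.2
  have hv : τ (v : B) = v := v.2
  have ht' : (u : B) - ε • (v : B) = 0 := by
    have h := congrArg τ ht
    rw [map_add, hτσ, hε, hu, hv, map_zero, neg_smul, ← sub_eq_add_neg] at h
    exact h
  have hu2 : (2 : L) • (u : B) = 0 := by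
    rw [two_smul]
    linear_combination ht + ht'
  have hu0 : (u : B) = 0 := (smul_eq_zero.mp hu2).resolve_left (two_ne_zero' L)
  have hv0 : (v : B) = 0 := by
    rw [hu0, zero_add] at ht
    exact (smul_eq_zero.mp ht).resolve_left hε0
  rw [show u = 0 from Subtype.ext hu0, show v = 0 from Subtype.ext hv0, TensorProduct.tmul_zero, TensorProduct.tmul_zero, add_zero]

/-- **`L ⊗_F B^τ ≅ B`** for a `σ`-semilinear involution `τ` of a commutative `L`-algebra `B`, `L ⊇ F` quadratic with `Aut(L/F) ∋ σ ≠ 1`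
(Galois descent for the quadratic extension: `B = B^τ ⊕ ε B^τ`). [cite: Lang2002, Ch. VI §5 Prop. 5.6] [cite: CasselsFrohlichANT1967, Ch. II §19 (19.5)] -/
theorem bijective_lift_ofId_val [CharZero F] (h2 : Module.finrank F L = 2) (hτ : ∀ b, τ (τ b) = b) (hσ : σ * σ = 1) (hσ1 : σ ≠ 1)
    (hτσ : ∀ (ℓ : L) (b : B), τ (ℓ • b) = σ ℓ • τ b) :
    Function.Bijective
      (lift (Algebra.ofId L B) (AlgHom.equalizer (τ : B →ₐ[F] B) (AlgHom.id F B)).val (fun _ _ => Commute.all _ _)) :=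
  ⟨injective_lift_ofId_val τ σ h2 hσ hσ1 hτσ, surjective_lift_ofId_val τ σ hτ hσ hσ1 hτσ⟩

end Quadratic

/-! ## §3 The norm of a base-changed element: `N_{(A' ⊗_L B)/A'}(θ (1⊗ι) x₀) = φ (N_{(A ⊗_F B^τ)/A}(x₀))` -/

section NormBaseChange

variable {F : Type} [Field F] {L : Type} [Field L] [Algebra F L] {B : Type} [CommRing B] [Algebra F B] [Algebra L B]
  [IsScalarTower F L B] (τ : B ≃ₐ[F] B) (σ : L ≃ₐ[F] L)
  {A : Type} [CommRing A] [Algebra F A] {A' : Type} [CommRing A'] [Algebra F A'] [Algebra L A'] [IsScalarTower F L A']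
  (φ : A →ₐ[F] A')

omit [Algebra L B] [IsScalarTower F L B] [Algebra L A'] [IsScalarTower F L A'] in
/-- **Naturality of the norm in the base** (Cassels–Fröhlich (19.15)–(19.17)): `N_{(A' ⊗_F S)/A'}((φ ⊗ 1) y) = φ (N_{(A ⊗_F S)/A}(y))` for a
finite-dimensional `F`-algebra `S` — the regular representation in the basis `1 ⊗ β` is natural in the base (★ `leftMulMatrix_basis_map`).
[cite: CasselsFrohlichANT1967, Ch. II §19 (19.15)–(19.17)] -/
theorem norm_map_eq_map_norm {S : Type} [CommRing S] [Algebra F S] [FiniteDimensional F S] (y : A ⊗[F] S) :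
    Algebra.norm A' (map φ (AlgHom.id F S) y) = φ (Algebra.norm A y) := by
  classical
  let β := Module.finBasis F S
  rw [Algebra.norm_eq_matrix_det (Algebra.TensorProduct.basis A' β), Algebra.norm_eq_matrix_det (Algebra.TensorProduct.basis A β),
    Literature.NumberTheory.AdelicBaseChange.leftMulMatrix_basis_map β φ y, AlgHom.map_det, AlgHom.mapMatrix_apply]

/-- The `A'`-algebra isomorphism `A' ⊗_F B^τ ≅ A' ⊗_L (L ⊗_F B^τ) ≅ A' ⊗_L B` (Mathlib `cancelBaseChange` and §2) sends `a' ⊗ b₀ ↦ a' ⊗ b₀`.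
[cite: CasselsFrohlichANT1967, Ch. II §19 (19.5)] -/
theorem cancelBaseChange_symm_trans_congr_tmul [CharZero F] (h2 : Module.finrank F L = 2) (hτ : ∀ b, τ (τ b) = b) (hσ : σ * σ = 1)
    (hσ1 : σ ≠ 1) (hτσ : ∀ (ℓ : L) (b : B), τ (ℓ • b) = σ ℓ • τ b) (a' : A')
    (b₀ : ↥(AlgHom.equalizer (τ : B →ₐ[F] B) (AlgHom.id F B))) :
    ((Algebra.TensorProduct.cancelBaseChange F L A' A' ↥(AlgHom.equalizer (τ : B →ₐ[F] B) (AlgHom.id F B))).symm.trans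
        (Algebra.TensorProduct.congr (AlgEquiv.refl : A' ≃ₐ[A'] A')
          (AlgEquiv.ofBijective _ (bijective_lift_ofId_val τ σ h2 hτ hσ hσ1 hτσ)))) (a' ⊗ₜ b₀) = a' ⊗ₜ (b₀ : B) := by
  rw [AlgEquiv.trans_apply, Algebra.TensorProduct.cancelBaseChange_symm_tmul, Algebra.TensorProduct.congr_apply,
    Algebra.TensorProduct.map_tmul]
  change a' ⊗ₜ (lift (Algebra.ofId L B) (AlgHom.equalizer (τ : B →ₐ[F] B) (AlgHom.id F B)).val (fun _ _ => Commute.all _ _)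
    ((1 : L) ⊗ₜ b₀)) = _
  rw [lift_ofId_val_tmul, one_smul]

/-- **THE NORM OF A BASE-CHANGED ELEMENT**: for any `F`-algebra map `θ : A ⊗_F B → A' ⊗_L B` with `θ (a ⊗ b) = φ a ⊗ b` (`A'` an `L`-algebra,
`φ : A → A'`; e.g. `A = 𝔸_F`, `A' = 𝔸_L`, `φ = con`) and `x₀ ∈ A ⊗_F B^τ`:
`N_{(A' ⊗_L B)/A'}(θ ((1 ⊗ ι) x₀)) = φ (N_{(A ⊗_F B^τ)/A}(x₀))` — `A' ⊗_F B^τ ≅ A' ⊗_L B` over `A'` (§2 + `cancelBaseChange`) and naturality in the base.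
At `B = L[γ₀]`: «`det x_g = con (N(X₀))`» [Rogawski1990, §3.5]. [cite: CasselsFrohlichANT1967, Ch. II §19 (19.5), (19.15)–(19.17)] [cite: Rogawski1990, §3.5 Prop. 3.5.2 p. 29] -/
theorem norm_apply_map_val_eq [CharZero F] [FiniteDimensional F B] (h2 : Module.finrank F L = 2) (hτ : ∀ b, τ (τ b) = b)
    (hσ : σ * σ = 1) (hσ1 : σ ≠ 1) (hτσ : ∀ (ℓ : L) (b : B), τ (ℓ • b) = σ ℓ • τ b)
    (θ : A ⊗[F] B →ₐ[F] A' ⊗[L] B) (hθ : ∀ (a : A) (b : B), θ (a ⊗ₜ b) = φ a ⊗ₜ b)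
    (x₀ : A ⊗[F] ↥(AlgHom.equalizer (τ : B →ₐ[F] B) (AlgHom.id F B))) :
    Algebra.norm A' (θ (map (AlgHom.id F A) (AlgHom.equalizer (τ : B →ₐ[F] B) (AlgHom.id F B)).val x₀)) =
      φ (Algebra.norm A x₀) := by
  set E := (Algebra.TensorProduct.cancelBaseChange F L A' A' ↥(AlgHom.equalizer (τ : B →ₐ[F] B) (AlgHom.id F B))).symm.trans
    (Algebra.TensorProduct.congr (AlgEquiv.refl : A' ≃ₐ[A'] A')
      (AlgEquiv.ofBijective _ (bijective_lift_ofId_val τ σ h2 hτ hσ hσ1 hτσ))) with hE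
  have key : ∀ y : A ⊗[F] ↥(AlgHom.equalizer (τ : B →ₐ[F] B) (AlgHom.id F B)),
      θ (map (AlgHom.id F A) (AlgHom.equalizer (τ : B →ₐ[F] B) (AlgHom.id F B)).val y) =
        E (map φ (AlgHom.id F ↥(AlgHom.equalizer (τ : B →ₐ[F] B) (AlgHom.id F B))) y) := by
    intro y
    induction y using TensorProduct.induction_on with
    | zero => rw [map_zero, map_zero, map_zero, map_zero]
    | tmul a b₀ =>
        rw [Algebra.TensorProduct.map_tmul, Algebra.TensorProduct.map_tmul, AlgHom.id_apply, AlgHom.id_apply, Subalgebra.coe_val, hθ,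
          hE, cancelBaseChange_symm_trans_congr_tmul τ σ h2 hτ hσ hσ1 hτσ]
    | add x y hx hy => rw [map_add, map_add, hx, hy, map_add, map_add]
  haveI : FiniteDimensional F ↥(AlgHom.equalizer (τ : B →ₐ[F] B) (AlgHom.id F B)) :=
    FiniteDimensional.finiteDimensional_submodule (Subalgebra.toSubmodule (AlgHom.equalizer (τ : B →ₐ[F] B) (AlgHom.id F B)))
  rw [key, Algebra.norm_eq_of_algEquiv, norm_map_eq_map_norm]

end NormBaseChange

end Literature.RingTheory.Etale
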